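import Summits.ResolutionOfSingularities.ResolutionOfSingularities.Theorems.FrobeniusClosingSteerSigmaTopMaximality
import HarnessLib

/-!
# Crux `Steer` (stmt-ResolutionOfSingularities-16345), chain W4.1 — hS1b W-TOI: **two odd divisors through the centre make a σ_top-PERMISSIBLE
# centre** (step (g) of res-L0-w41-strat-2's hS1b PROOF MAP v1.0; member level, characteristic `2`; Theses-free, def-free)

OURS (campaign `res-hironaka`, rung L ★L-G4, slot W4.1; seat res-D-lib-2 g10 on res-L0-w41-plan-1 RULINGS 264(d)/284 (2); word W-TOI
`ReducedOrder.TwoOddIllegal` of `…ReducedOrderWords` (strat-2 `S1B/ReducedOrderWords_sketch.lean` fb31e0fd4d0a20c0, tri-1 VERDICT-S1b PASS): this file proves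
its body with the binders in the word's order, so that `twoOddIllegal : ReducedOrder.TwoOddIllegal K := fun … => isPermissibleCentre_of_two_odd …` is a one-liner
once the words file (p566435) is in the tree). Candidates, not facts; nothing here is a statement of H. Hironaka's manuscript [Hironaka2017] (status: under
review). AI-written; AI review is weaker than expert review.

* `isPermissibleCentre_of_two_odd` — on a regular local member `R ⊆ K` of dimension `4`: `a` prime, `a ∤ b`, `a ∈ 𝔪 ∖ 𝔪²`, `(a, b)` prime with regular quotient,
  `f ≡ ga² (mod a)`, `f ≡ gb² (mod b)`, no singular prime of height `0` or `1` ⇒ `Words.IsPermissibleCentre R 2 f (a, b)`. Chain (strat-2 (g)):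
  `SigmaTopLegality.sub_sq_mem_span_mul_span_pair` ⇒ `f = ga² + a·G`, `G ∈ (a, b)`; `G ∉ (a)` (else `(a)` would be a singular prime of height `1`,
  `AutoPermissible.singular_atPrime_of_sub_pow_mem_sq`); `SigmaTopLegality.oddDivisor_fork` at a minimal prime `Q ⊆ (a, b)` of `(a, G)`: `Q` has height `2`
  and `IsPermissibleCentre … Q ↔ R ⧸ Q regular`; `(a, b)` has height `≤ 2` (two generators), so `Q = (a, b)` (`Ideal.eq_of_le_of_height_le`), and the quotient
  is regular by hypothesis. This is Hauser–Perlega's «two lost odd components» step in the typed currency.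
[cite: Matsumura1987, Thm. 14.2] [folklore]
-/

-- `Summit.<S>.<S>.…` duplicates the summit name by design (single-problem summit).
set_option linter.dupNamespace false

open IsLocalRing
open Literature.AlgebraicGeometry.Resolution
open Summit.ResolutionOfSingularities.ResolutionOfSingularities.Theorems.SwitchingDichotomy

namespace Summit.ResolutionOfSingularities.ResolutionOfSingularities.Theorems.SwitchingDichotomy.TwoOddIllegal

variable {K : Type} [Field K]

/-- **Two odd divisors are illegal at a point step** (W-TOI's body). See the module docstring. OURS. [cite: Matsumura1987, Thm. 14.2] [folklore] -/
theorem isPermissibleCentre_of_two_odd [CharP K 2] (R : Subring K) [IsRegularLocalRing R] (hdim : ringKrullDim R = (4 : ℕ))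
    (f a b ga gb : R) (hpa : Prime a) (hab : ¬ a ∣ b) (ham : a ∈ maximalIdeal R) (ha2 : a ∉ maximalIdeal R ^ 2)
    (hP : (Ideal.span ({a, b} : Set R)).IsPrime) (hreg : IsRegularLocalRing (R ⧸ Ideal.span ({a, b} : Set R)))
    (hfa : f - ga ^ 2 ∈ Ideal.span {a}) (hfb : f - gb ^ 2 ∈ Ideal.span {b})
    (h0 : ∀ (Q : Ideal R) [Q.IsPrime], Q.height = 0 → ¬ SigmaTopLegality.IsSingPrime R 2 f Q)
    (h1 : ∀ (Q : Ideal R) [Q.IsPrime], Q.height = 1 → ¬ SigmaTopLegality.IsSingPrime R 2 f Q) :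
    Words.IsPermissibleCentre R 2 f (Ideal.span ({a, b} : Set R)) := by
  classical
  haveI := hP
  haveI : Fact (Nat.Prime 2) := ⟨Nat.prime_two⟩
  -- `f − ga² = a·G` with `G ∈ (a, b)`
  have hmul := SigmaTopLegality.sub_sq_mem_span_mul_span_pair hpa hab hP.isRadical hfa hfb
  obtain ⟨G, hG, hfG⟩ := Ideal.mem_span_singleton_mul.mp hmul
  have hf : f = ga ^ 2 + a * G := by linear_combination (-1 : R) * hfG
  -- `G ∉ (a)`: otherwise `(a)` would be a singular prime of height one
  have hGa : G ∉ Ideal.span ({a} : Set R) := by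
    intro hGa
    haveI : (Ideal.span ({a} : Set R)).IsPrime := (Ideal.span_singleton_prime hpa.ne_zero).mpr hpa
    have hsq : f - ga ^ 2 ∈ Ideal.span ({a} : Set R) ^ 2 := by
      rw [← hfG, pow_two]
      exact Ideal.mul_mem_mul (Ideal.mem_span_singleton_self a) hGa
    have hsing : SigmaTopLegality.IsSingPrime R 2 f (Ideal.span {a}) :=
      AutoPermissible.singular_atPrime_of_sub_pow_mem_sq K 2 R f (Ideal.span {a}) hsq
    have hht : (Ideal.span ({a} : Set R)).height = 1 :=
      Ideal.height_span_singleton_eq_one_of_mem_nonZeroDivisors (mem_nonZeroDivisors_of_ne_zero hpa.ne_zero) hpa.not_unit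
    exact h1 _ hht hsing
  -- the fork at a minimal prime `Q ⊆ (a, b)` of `(a, G)`
  have hle : Ideal.span ({a, G} : Set R) ≤ Ideal.span ({a, b} : Set R) := by
    rw [Ideal.span_le]
    rintro z (rfl | rfl)
    · exact Ideal.subset_span (by simp)
    · exact hG
  obtain ⟨Q, hQmin, hQle⟩ := Ideal.exists_minimalPrimes_le hle
  haveI hQp : Q.IsPrime := hQmin.1.1
  obtain ⟨-, hiff⟩ := SigmaTopLegality.oddDivisor_fork R f ga a G hf ham ha2 hGa h0 h1 (c := 4) (by norm_num) hdim hQmin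
  have hQ2 : Q.height = 2 := SigmaTopLegality.height_eq_two_of_not_mem_sq R ham ha2 hGa hQmin
  -- `(a, b)` has height `≤ 2`, hence `Q = (a, b)`
  have hPab2 : (Ideal.span ({a, b} : Set R)).height ≤ 2 := by
    have hmem : Ideal.span ({a, b} : Set R) ∈ (Ideal.span ({a, b} : Set R)).minimalPrimes := by
      rw [Ideal.minimalPrimes_eq_subsingleton_self]; exact Set.mem_singleton _
    have h := Ideal.height_le_card_of_mem_minimalPrimes_span (Set.toFinite _) hmem
    have hcard : ({a, b} : Set R).ncard ≤ 2 := by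
      refine (Set.ncard_insert_le a {b}).trans ?_
      rw [Set.ncard_singleton]
    exact h.trans (by exact_mod_cast hcard)
  have hQeq : Q = Ideal.span ({a, b} : Set R) :=
    Ideal.eq_of_le_of_height_le Q hQle (by rw [hQ2]; exact hPab2)
  subst hQeq
  exact (SigmaTopMaximality.isPermissibleCentre_iff R 2 f _).mp (hiff.mpr hreg)

end Summit.ResolutionOfSingularities.ResolutionOfSingularities.Theorems.SwitchingDichotomy.TwoOddIllegal
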